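import Literature.Analysis.FluidPDE.FujitaKatoPicard
import Literature.Analysis.FluidPDE.NSFourierPlancherel
import Mathlib.Analysis.Fourier.Convolution
import Mathlib.MeasureTheory.Function.ConvergenceInMeasure
import HarnessLib

/-!
# `L²` Fourier toolkit for the Fujita–Kato dictionary

Support file of the discharge programme for `Literature.Analysis.FluidPDE.fujita_kato_local`
(dictionary step `FujitaKato.exists_mildSolution_of_isFourierNSSolution`, plan in
`Literature/Analysis/FluidPDE/FujitaKatoLocal.lean`; Lemarié-Rieusset, *The Navier–Stokes
problem in the 21st century*, 2nd ed., §8.7, (8.8), PDF p. 198: the dictionary between a mild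
solution `u` and its spatial Fourier transform). A Fourier-side solution `v(t) ∈ L²(dξ)` of the
Fujita–Kato class is in general *not* integrable (`𝓕Ḣ¹(ℝ³) ⊄ L¹`), so the physical field must
be produced by the `L²` (Plancherel) Fourier transform, for which Mathlib (this pin) provides only
the isometry `MeasureTheory.Lp.fourierTransformₗᵢ`, its agreement with the Schwartz transform
and with tempered distributions. This file supplies the three identities the dictionary needs,
for measurable, square-integrable, Hermitian (`a(-ξ) = conj a(ξ)`) coefficient fields
`a : ℝ^ι → ℂ^ι` and the physical `L²` class `U = 𝓕⁻¹[ξ ↦ a(-ξ)]` (`physLp`, so that `𝓕 U`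
is the class of `a(-·)`):

* `fourier_toLp_ae_eq_vec`, `fourierInv_toLp_ae_eq_vec`: for vector-valued `L¹ ∩ L²`
  functions the `L²` (inverse) Fourier transform is the Fourier integral a.e. (both induce the
  same tempered distribution; vector form of the tree's `FourierNS.fourier_toLp_ae_eq`);
* **linear pairing** (`integral_sum_conj_physLp_mul`): for Schwartz `Θ_l`,
  `∫ ∑_l conj(U_l) Θ_l dx = ∫ ∑_l a_l(ξ) 𝓕Θ_l(ξ) dξ` (Plancherel `⟪𝓕⁻¹A, Θ⟫ = ⟪A, 𝓕Θ⟫` and the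
  Hermitian symmetry);
* **reality** (`physLp_conj_ae`): `U` is a.e. real, `conj U_l = U_l` (truncations
  `a 1_{‖ξ‖≤R} ∈ L¹ ∩ L²` have pointwise real Fourier integrals, `L²` limit);
* **quadratic pairing** (`integral_physLp_mul_physLp_mul`): for Schwartz `θ`,
  `∫ U_j U_l θ dx = ∫ (a_j ⋆ a_l)(ζ) 𝓕θ(ζ) dζ` (`fconv` of the tree), proved for the truncations
  by Fubini (`∫ 𝓕f 𝓕g θ = ∫ (f ⋆ g) 𝓕θ` for `f, g ∈ L¹`) and passed to the limit
  (`L²` convergence on the left, dominated convergence on the right).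

## Mathlib search

`MeasureTheory.Lp.inner_fourier_eq`, `Lp.fourier_fourierInv_eq` (instance `FourierInvPair`),
`MeasureTheory.Lp.fourierInv_toTemperedDistribution_eq`, `TemperedDistribution.fourierInv_apply`,
`VectorFourier.integral_fourierIntegral_smul_eq_flip`, `Real.fourierInv_eq_fourier_neg`,
`MeasureTheory.L2.inner_def`, `ae_eq_of_integral_contDiff_smul_eq`,
`MemLp.mono_exponent_of_measure_support_ne_top` (truncations are integrable),
`tendstoInMeasure_of_tendsto_eLpNorm` / `TendstoInMeasure.exists_seq_tendsto_ae`,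
`MeasureTheory.integral_prod_mul`, `Integrable.convolution_integrand`, `integral_integral_swap`.
No Mathlib statement computes `𝓕⁻¹` of an `L²` class pointwise or its products (searched
`fourierTransformₗᵢ`, `Lp.fourier`).

## References

* P. G. Lemarié-Rieusset, *The Navier–Stokes problem in the 21st century*, 2nd ed., CRC Press
  2023, §8.7 (8.8), PDF p. 198. [Lemarierieusset2023]
* E. M. Stein, G. Weiss, *Introduction to Fourier Analysis on Euclidean Spaces*, PUP 1971,
  Ch. I, §2 (Plancherel, multiplication formula).
-/

noncomputable section

open MeasureTheory Set Function Filter Topology Real SchwartzMap FourierTransform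
open scoped ENNReal NNReal ComplexConjugate InnerProductSpace

namespace Literature.Analysis.FluidPDE.FujitaKato

/-! ### The `L²` Fourier transform of vector-valued `L¹ ∩ L²` functions -/

section VectorFlip

variable {V : Type*} [NormedAddCommGroup V] [InnerProductSpace ℝ V] [FiniteDimensional ℝ V]
  [MeasurableSpace V] [BorelSpace V]
variable {F : Type*} [NormedAddCommGroup F] [NormedSpace ℂ F] [CompleteSpace F]

/-- Self-adjointness of the Fourier integral against a Schwartz test function, vector-valued:
`∫ (𝓕 g)(x) • w(x) dx = ∫ g(ξ) • (𝓕 w)(ξ) dξ` for integrable `w`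
(Mathlib `VectorFourier.integral_fourierIntegral_smul_eq_flip`). [folklore] -/
theorem integral_fourier_schwartz_smul_eq_vec {w : V → F} (hw : Integrable w)
    (g : 𝓢(V, ℂ)) :
    ∫ x, (𝓕 (g : V → ℂ)) x • w x = ∫ ξ, g ξ • (𝓕 w) ξ := by
  have h := VectorFourier.integral_fourierIntegral_smul_eq_flip (e := 𝐞) (μ := volume)
    (ν := volume) (L := innerₗ V) (f := (g : V → ℂ)) (g := w) Real.continuous_fourierChar
    continuous_inner g.integrable hw
  have hflip : (innerₗ V).flip = innerₗ V := by
    ext v w'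
    rw [LinearMap.flip_apply, innerₗ_apply_apply, innerₗ_apply_apply, real_inner_comm]
  rw [hflip] at h
  exact h

/-- The same for the inverse transform: `∫ (𝓕⁻ g)(x) • w(x) dx = ∫ g(ξ) • (𝓕⁻ w)(ξ) dξ`
(reflect `ξ ↦ -ξ` in the previous identity). [folklore] -/
theorem integral_fourierInv_schwartz_smul_eq_vec {w : V → F} (hw : Integrable w)
    (g : 𝓢(V, ℂ)) :
    ∫ x, (𝓕⁻ (g : V → ℂ)) x • w x = ∫ ξ, g ξ • (𝓕⁻ w) ξ := by
  set gn : 𝓢(V, ℂ) := SchwartzMap.compCLMOfContinuousLinearEquiv ℂ (ContinuousLinearEquiv.neg ℝ) g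
    with hgn
  have hgn_apply : ∀ ξ, gn ξ = g (-ξ) := fun ξ => by
    simp [hgn, SchwartzMap.compCLMOfContinuousLinearEquiv_apply]
  have h1 : (𝓕⁻ (g : V → ℂ)) = 𝓕 (gn : V → ℂ) := by
    rw [Real.fourierInv_eq_fourier_comp_neg]
    exact congrArg _ (funext fun ξ => (hgn_apply ξ).symm)
  rw [h1, integral_fourier_schwartz_smul_eq_vec hw gn]
  simp_rw [hgn_apply, Real.fourierInv_eq_fourier_neg w]
  rw [← integral_neg_eq_self (fun ξ => g ξ • 𝓕 w (-ξ)) volume]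
  simp only [neg_neg]

end VectorFlip

section VectorPlancherel

variable {V : Type*} [NormedAddCommGroup V] [InnerProductSpace ℝ V] [FiniteDimensional ℝ V]
  [MeasurableSpace V] [BorelSpace V]
variable {F : Type*} [NormedAddCommGroup F] [InnerProductSpace ℂ F] [CompleteSpace F]

/-- **The `L²` Fourier transform of a vector-valued `L¹ ∩ L²` function is its Fourier integral**
(a.e.; both induce the tempered distribution `𝓕 T_w`; vector form of the tree's
`FourierNS.fourier_toLp_ae_eq`). [folklore] -/
theorem fourier_toLp_ae_eq_vec {w : V → F} (hw : Integrable w) (hw2 : MemLp w 2 volume) :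
    ((𝓕 (hw2.toLp w) : Lp F 2 (volume : Measure V)) : V → F) =ᵐ[volume] 𝓕 w := by
  set W₂ : Lp F 2 (volume : Measure V) := hw2.toLp w with hW₂
  set U : Lp F 2 (volume : Measure V) := 𝓕 W₂ with hU
  have hW₂w : (W₂ : V → F) =ᵐ[volume] w := hw2.coeFn_toLp
  have key : ∀ g : 𝓢(V, ℂ), ∫ x, g x • (U : V → F) x = ∫ x, g x • 𝓕 w x := by
    intro g
    have h1 : ∫ x, g x • (U : V → F) x = (Lp.toTemperedDistribution U) g :=
      (Lp.toTemperedDistribution_apply U g).symm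
    have h2 : Lp.toTemperedDistribution U = 𝓕 (Lp.toTemperedDistribution W₂) :=
      (Lp.fourier_toTemperedDistribution_eq W₂).symm
    rw [h1, h2, TemperedDistribution.fourier_apply, Lp.toTemperedDistribution_apply,
      ← integral_fourier_schwartz_smul_eq_vec hw g, SchwartzMap.fourier_coe]
    refine integral_congr_ae ?_
    filter_upwards [hW₂w] with x hx
    rw [hx]
  refine ae_eq_of_integral_contDiff_smul_eq ((Lp.memLp U).locallyIntegrable (by norm_num))
    (VectorFourier.fourierIntegral_continuous Real.continuous_fourierChar continuous_inner
      hw).locallyIntegrable fun φ hφ hsupp => ?_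
  have hφc : HasCompactSupport fun x => ((φ x : ℝ) : ℂ) := hsupp.comp_left Complex.ofReal_zero
  have hφs : ContDiff ℝ (⊤ : ℕ∞) fun x => ((φ x : ℝ) : ℂ) := Complex.ofRealCLM.contDiff.comp hφ
  have h := key (hφc.toSchwartzMap hφs)
  have hcoe : ∀ x, (hφc.toSchwartzMap hφs) x = ((φ x : ℝ) : ℂ) := fun x => rfl
  simp only [hcoe] at h
  simpa only [Complex.real_smul, Complex.coe_smul] using h

/-- **The `L²` inverse Fourier transform of a vector-valued `L¹ ∩ L²` function is its inverse
Fourier integral** (a.e.). [folklore] -/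
theorem fourierInv_toLp_ae_eq_vec {w : V → F} (hw : Integrable w) (hw2 : MemLp w 2 volume) :
    ((𝓕⁻ (hw2.toLp w) : Lp F 2 (volume : Measure V)) : V → F) =ᵐ[volume] 𝓕⁻ w := by
  set W₂ : Lp F 2 (volume : Measure V) := hw2.toLp w with hW₂
  set U : Lp F 2 (volume : Measure V) := 𝓕⁻ W₂ with hU
  have hW₂w : (W₂ : V → F) =ᵐ[volume] w := hw2.coeFn_toLp
  have hcont : Continuous (𝓕⁻ w) := by
    rw [Real.fourierInv_eq_fourier_comp_neg]
    exact VectorFourier.fourierIntegral_continuous Real.continuous_fourierChar continuous_inner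
      (hw.comp_neg)
  have key : ∀ g : 𝓢(V, ℂ), ∫ x, g x • (U : V → F) x = ∫ x, g x • 𝓕⁻ w x := by
    intro g
    have h1 : ∫ x, g x • (U : V → F) x = (Lp.toTemperedDistribution U) g :=
      (Lp.toTemperedDistribution_apply U g).symm
    have h2 : Lp.toTemperedDistribution U = 𝓕⁻ (Lp.toTemperedDistribution W₂) :=
      (Lp.fourierInv_toTemperedDistribution_eq W₂).symm
    rw [h1, h2, TemperedDistribution.fourierInv_apply, Lp.toTemperedDistribution_apply,
      ← integral_fourierInv_schwartz_smul_eq_vec hw g, SchwartzMap.fourierInv_coe]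
    refine integral_congr_ae ?_
    filter_upwards [hW₂w] with x hx
    rw [hx]
  refine ae_eq_of_integral_contDiff_smul_eq ((Lp.memLp U).locallyIntegrable (by norm_num))
    hcont.locallyIntegrable fun φ hφ hsupp => ?_
  have hφc : HasCompactSupport fun x => ((φ x : ℝ) : ℂ) := hsupp.comp_left Complex.ofReal_zero
  have hφs : ContDiff ℝ (⊤ : ℕ∞) fun x => ((φ x : ℝ) : ℂ) := Complex.ofRealCLM.contDiff.comp hφ
  have h := key (hφc.toSchwartzMap hφs)
  have hcoe : ∀ x, (hφc.toSchwartzMap hφs) x = ((φ x : ℝ) : ℂ) := fun x => rfl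
  simp only [hcoe] at h
  simpa only [Complex.real_smul, Complex.coe_smul] using h

end VectorPlancherel

/-! ### Coefficient vectors and Euclidean vectors -/

section Euc

variable {ι : Type*} [Fintype ι]

/-- A coefficient vector `ι → ℂ` as a vector of `ℂ^ι = EuclideanSpace ℂ ι`. [folklore] -/
def toEuc (y : ι → ℂ) : EuclideanSpace ℂ ι := WithLp.toLp 2 y

omit [Fintype ι] in
/-- Coordinates of `toEuc`. [folklore] -/
@[simp]
theorem toEuc_apply (y : ι → ℂ) (i : ι) : toEuc y i = y i := rfl

/-- `toEuc` as a sum over the standard basis. [folklore] -/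
theorem toEuc_eq_sum [DecidableEq ι] (y : ι → ℂ) : toEuc y = ∑ i, y i • EuclideanSpace.single i (1 : ℂ) := by
  ext j
  simp [toEuc, Finset.sum_apply, Pi.single_apply]

/-- `ℓ² ≤ ℓ¹`: `‖toEuc y‖ ≤ ∑ ‖y i‖`. [folklore] -/
theorem norm_toEuc_le_sum (y : ι → ℂ) : ‖toEuc y‖ ≤ ∑ i, ‖y i‖ := by
  classical
  rw [toEuc_eq_sum]
  refine (norm_sum_le _ _).trans (le_of_eq (Finset.sum_congr rfl fun i _ => ?_))
  rw [norm_smul, PiLp.norm_single, norm_one, mul_one]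

/-- A coefficient is bounded by the Euclidean norm. [folklore] -/
theorem norm_apply_le_norm_toEuc (y : ι → ℂ) (i : ι) : ‖y i‖ ≤ ‖toEuc y‖ :=
  PiLp.norm_apply_le (toEuc y) i

/-- The sup norm is bounded by the Euclidean norm. [folklore] -/
theorem pi_norm_le_norm_toEuc (y : ι → ℂ) : ‖y‖ ≤ ‖toEuc y‖ :=
  (pi_norm_le_iff_of_nonneg (norm_nonneg _)).2 (norm_apply_le_norm_toEuc y)

/-- The Euclidean norm is bounded by `card ι` times the sup norm: `‖toEuc y‖ ≤ ∑ ‖y i‖ ≤ card ι ‖y‖`. [folklore] -/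
theorem norm_toEuc_le (y : ι → ℂ) : ‖toEuc y‖ ≤ Fintype.card ι * ‖y‖ := by
  refine (norm_toEuc_le_sum y).trans ?_
  calc ∑ i, ‖y i‖ ≤ ∑ _i : ι, ‖y‖ := Finset.sum_le_sum fun i _ => norm_le_pi_norm y i
    _ = Fintype.card ι * ‖y‖ := by simp

/-- `ℝ≥0∞` form: `‖toEuc y‖ₑ ≤ card ι ‖y‖ₑ`. [folklore] -/
theorem enorm_toEuc_le (y : ι → ℂ) : ‖toEuc y‖ₑ ≤ Fintype.card ι * ‖y‖ₑ := by
  rw [← ofReal_norm, ← ofReal_norm, ← ENNReal.ofReal_natCast, ← ENNReal.ofReal_mul (Nat.cast_nonneg _)]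
  exact ENNReal.ofReal_le_ofReal (norm_toEuc_le y)

/-- `ℝ≥0∞` form: `‖y‖ₑ ≤ ‖toEuc y‖ₑ`. [folklore] -/
theorem pi_enorm_le_enorm_toEuc (y : ι → ℂ) : ‖y‖ₑ ≤ ‖toEuc y‖ₑ := by
  rw [← ofReal_norm, ← ofReal_norm]
  exact ENNReal.ofReal_le_ofReal (pi_norm_le_norm_toEuc y)

omit [Fintype ι] in
/-- `toEuc` is continuous. [folklore] -/
theorem continuous_toEuc : Continuous (toEuc : (ι → ℂ) → EuclideanSpace ℂ ι) :=
  PiLp.continuous_toLp 2 _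

omit [Fintype ι] in
/-- `toEuc` is additive. [folklore] -/
theorem toEuc_sub (y z : ι → ℂ) : toEuc (y - z) = toEuc y - toEuc z := rfl

end Euc

/-! ### The physical `L²` class of a Hermitian coefficient field -/

section Phys

variable {ι : Type*} [Fintype ι]

/-- The reflected coefficient field as a Euclidean-vector-valued function, `ξ ↦ a(-ξ) ∈ ℂ^ι`
(the Fourier transform of the physical field when `u = 𝓕⁻¹[a(-·)]`, i.e. morally `u = 𝓕 a`). [folklore] -/
def negEuc (a : EuclideanSpace ℝ ι → ι → ℂ) (ξ : EuclideanSpace ℝ ι) : EuclideanSpace ℂ ι :=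
  toEuc (a (-ξ))

omit [Fintype ι] in
/-- Coordinates of `negEuc`. [folklore] -/
@[simp]
theorem negEuc_apply (a : EuclideanSpace ℝ ι → ι → ℂ) (ξ : EuclideanSpace ℝ ι) (i : ι) :
    negEuc a ξ i = a (-ξ) i := rfl

/-- `negEuc a` is measurable. [folklore] -/
theorem measurable_negEuc {a : EuclideanSpace ℝ ι → ι → ℂ} (ha : Measurable a) : Measurable (negEuc a) :=
  continuous_toEuc.measurable.comp (ha.comp measurable_neg)

/-- `∫⁻ ‖negEuc a‖² ≤ card² ∫⁻ ‖a‖²`. [folklore] -/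
theorem lintegral_enorm_negEuc_sq_le (a : EuclideanSpace ℝ ι → ι → ℂ) :
    ∫⁻ ξ, ‖negEuc a ξ‖ₑ ^ 2 ≤ (Fintype.card ι : ℝ≥0∞) ^ 2 * ∫⁻ ξ, ‖a ξ‖ₑ ^ 2 := by
  calc ∫⁻ ξ, ‖negEuc a ξ‖ₑ ^ 2
      ≤ ∫⁻ ξ : EuclideanSpace ℝ ι, (Fintype.card ι : ℝ≥0∞) ^ 2 * ‖a (-ξ)‖ₑ ^ 2 :=
        lintegral_mono fun ξ => by
          rw [negEuc, ← mul_pow]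
          gcongr
          exact enorm_toEuc_le _
    _ = (Fintype.card ι : ℝ≥0∞) ^ 2 * ∫⁻ ξ : EuclideanSpace ℝ ι, ‖a (-ξ)‖ₑ ^ 2 :=
        lintegral_const_mul' _ _ (ENNReal.pow_ne_top (ENNReal.natCast_ne_top _))
    _ = (Fintype.card ι : ℝ≥0∞) ^ 2 * ∫⁻ ξ, ‖a ξ‖ₑ ^ 2 := by
        rw [lintegral_neg_eq_self (fun ξ => ‖a ξ‖ₑ ^ 2)]

omit [Fintype ι] in
/-- A measurable function with `∫⁻ ‖f‖² < ∞` is in `L²`. [folklore] -/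
theorem memLp_two_of_lintegral_sq_lt_top {X : Type*} [MeasurableSpace X] {μ : Measure X}
    {F : Type*} [NormedAddCommGroup F] {f : X → F}
    (hf : AEStronglyMeasurable f μ) (h2 : ∫⁻ ξ, ‖f ξ‖ₑ ^ 2 ∂μ < ∞) : MemLp f 2 μ := by
  refine ⟨hf, ?_⟩
  rw [eLpNorm_eq_lintegral_rpow_enorm_toReal (by norm_num) (by norm_num)]
  refine ENNReal.rpow_lt_top_of_nonneg (by norm_num) (ne_of_lt ?_)
  simpa using h2

omit [Fintype ι] in
/-- Conversely, an `L²` function has `∫⁻ ‖f‖² < ∞`. [folklore] -/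
theorem lintegral_sq_lt_top_of_memLp_two {X : Type*} [MeasurableSpace X] {μ : Measure X}
    {F : Type*} [NormedAddCommGroup F] {f : X → F}
    (hf : MemLp f 2 μ) : ∫⁻ ξ, ‖f ξ‖ₑ ^ 2 ∂μ < ∞ := by
  have h := lintegral_rpow_enorm_lt_top_of_eLpNorm_lt_top (by norm_num) (by norm_num) hf.eLpNorm_lt_top
  simpa using h

/-- `negEuc a ∈ L²` for measurable `a` with `∫⁻ ‖a‖² < ∞`. [folklore] -/
theorem memLp_negEuc {a : EuclideanSpace ℝ ι → ι → ℂ} (ha : Measurable a) (h2 : ∫⁻ ξ, ‖a ξ‖ₑ ^ 2 < ∞) :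
    MemLp (negEuc a) 2 (volume : Measure (EuclideanSpace ℝ ι)) :=
  memLp_two_of_lintegral_sq_lt_top (measurable_negEuc ha).aestronglyMeasurable
    (lt_of_le_of_lt (lintegral_enorm_negEuc_sq_le a)
      (ENNReal.mul_lt_top (ENNReal.pow_lt_top (ENNReal.natCast_lt_top _)) h2))

/-- **The physical `L²` class** `U = 𝓕⁻¹[ξ ↦ a(-ξ)] ∈ L²(ℝ^ι; ℂ^ι)` of a square-integrable
coefficient field `a` (so that `𝓕 U` is the class of `a(-·)`; Lemarié-Rieusset 2023, §8.7, the
physical field `u` of the Fourier-side unknown `U`). [cite: Lemarierieusset2023, §8.7 (8.8) (PDF p. 198)] -/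
def physLp {a : EuclideanSpace ℝ ι → ι → ℂ} (ha : Measurable a) (h2 : ∫⁻ ξ, ‖a ξ‖ₑ ^ 2 < ∞) :
    Lp (EuclideanSpace ℂ ι) 2 (volume : Measure (EuclideanSpace ℝ ι)) :=
  𝓕⁻ ((memLp_negEuc ha h2).toLp (negEuc a))

/-- `𝓕 U` is the class of `a(-·)`. [folklore] -/
theorem fourier_physLp {a : EuclideanSpace ℝ ι → ι → ℂ} (ha : Measurable a) (h2 : ∫⁻ ξ, ‖a ξ‖ₑ ^ 2 < ∞) :
    (𝓕 (physLp ha h2) : Lp (EuclideanSpace ℂ ι) 2 (volume : Measure (EuclideanSpace ℝ ι))) =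
      (memLp_negEuc ha h2).toLp (negEuc a) :=
  fourier_fourierInv_eq _

/-- `𝓕 U = a(-·)` almost everywhere (as functions). [folklore] -/
theorem coeFn_fourier_physLp {a : EuclideanSpace ℝ ι → ι → ℂ} (ha : Measurable a)
    (h2 : ∫⁻ ξ, ‖a ξ‖ₑ ^ 2 < ∞) :
    ((𝓕 (physLp ha h2) : Lp (EuclideanSpace ℂ ι) 2 (volume : Measure (EuclideanSpace ℝ ι))) :
      EuclideanSpace ℝ ι → EuclideanSpace ℂ ι) =ᵐ[volume] negEuc a := by
  rw [fourier_physLp]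
  exact MemLp.coeFn_toLp _

/-! ### The linear pairing -/

/-- A family of Schwartz functions as a Euclidean-vector-valued test field. [folklore] -/
def schwartzVec (Θ : ι → 𝓢(EuclideanSpace ℝ ι, ℂ)) (x : EuclideanSpace ℝ ι) : EuclideanSpace ℂ ι :=
  toEuc fun l => Θ l x

/-- Coordinates of `schwartzVec`. [folklore] -/
@[simp]
theorem schwartzVec_apply (Θ : ι → 𝓢(EuclideanSpace ℝ ι, ℂ)) (x : EuclideanSpace ℝ ι) (l : ι) :
    schwartzVec Θ x l = Θ l x := rfl

/-- `schwartzVec Θ` is continuous. [folklore] -/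
theorem continuous_schwartzVec (Θ : ι → 𝓢(EuclideanSpace ℝ ι, ℂ)) : Continuous (schwartzVec Θ) :=
  continuous_toEuc.comp (continuous_pi fun l => (Θ l).continuous)

/-- `‖schwartzVec Θ x‖ ≤ ∑ ‖Θ_l x‖`. [folklore] -/
theorem norm_schwartzVec_le (Θ : ι → 𝓢(EuclideanSpace ℝ ι, ℂ)) (x : EuclideanSpace ℝ ι) :
    ‖schwartzVec Θ x‖ ≤ ∑ l, ‖Θ l x‖ :=
  norm_toEuc_le_sum _

/-- `schwartzVec Θ` is integrable. [folklore] -/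
theorem integrable_schwartzVec (Θ : ι → 𝓢(EuclideanSpace ℝ ι, ℂ)) : Integrable (schwartzVec Θ) := by
  have hg : Integrable (fun x : EuclideanSpace ℝ ι => ∑ l, ‖Θ l x‖) :=
    integrable_finsetSum Finset.univ fun l _ => (Θ l).integrable.norm
  exact hg.mono' (continuous_schwartzVec Θ).aestronglyMeasurable
    (Eventually.of_forall (norm_schwartzVec_le Θ))

/-- `schwartzVec Θ ∈ L²`. [folklore] -/
theorem memLp_schwartzVec (Θ : ι → 𝓢(EuclideanSpace ℝ ι, ℂ)) : MemLp (schwartzVec Θ) 2 volume := by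
  have hg : MemLp (fun x : EuclideanSpace ℝ ι => ∑ l, ‖Θ l x‖) 2 volume :=
    memLp_finsetSum Finset.univ fun l _ => ((Θ l).memLp 2 volume).norm
  refine MemLp.of_le hg (continuous_schwartzVec Θ).aestronglyMeasurable (Eventually.of_forall fun x => ?_)
  rw [Real.norm_of_nonneg (Finset.sum_nonneg fun l _ => norm_nonneg _)]
  exact norm_schwartzVec_le Θ x

/-- The Fourier integral of `schwartzVec Θ`, coordinatewise. [folklore] -/
theorem fourier_schwartzVec_apply (Θ : ι → 𝓢(EuclideanSpace ℝ ι, ℂ)) (ξ : EuclideanSpace ℝ ι) (l : ι) :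
    𝓕 (schwartzVec Θ) ξ l = 𝓕 (Θ l : EuclideanSpace ℝ ι → ℂ) ξ := by
  rw [Real.fourier_eq, Real.fourier_eq]
  have hint : Integrable (fun v : EuclideanSpace ℝ ι => 𝐞 (-⟪v, ξ⟫_ℝ) • schwartzVec Θ v) :=
    (Real.fourierIntegral_convergent_iff ξ).2 (integrable_schwartzVec Θ)
  have h := (EuclideanSpace.proj (𝕜 := ℂ) l).integral_comp_comm hint
  simp only [PiLp.proj_apply] at h
  rw [← h]
  rfl

/-- **The linear pairing** (Plancherel duality for the physical class): for a measurable,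
square-integrable, Hermitian coefficient field `a` and Schwartz `Θ_l`,
`∫ ∑_l conj(U_l(x)) Θ_l(x) dx = ∫ ∑_l a_l(ξ) 𝓕Θ_l(ξ) dξ`, `U = physLp` (`⟪𝓕⁻¹A, Θ⟫ = ⟪A, 𝓕Θ⟫`,
Mathlib `Lp.inner_fourier_eq`, then `conj a(-ξ) = a(ξ)`; Lemarié-Rieusset 2023, §8.7, the
Fourier transform of the pairing). [cite: Lemarierieusset2023, §8.7 (8.8) (PDF p. 198)] -/
theorem integral_sum_conj_physLp_mul {a : EuclideanSpace ℝ ι → ι → ℂ} (ha : Measurable a)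
    (h2 : ∫⁻ ξ, ‖a ξ‖ₑ ^ 2 < ∞)
    (hsymm : ∀ᵐ ξ : EuclideanSpace ℝ ι ∂volume, ∀ j, a (-ξ) j = conj (a ξ j))
    (Θ : ι → 𝓢(EuclideanSpace ℝ ι, ℂ)) :
    ∫ x, ∑ l, conj ((physLp ha h2 : EuclideanSpace ℝ ι → EuclideanSpace ℂ ι) x l) * Θ l x =
      ∫ ξ, ∑ l, a ξ l * 𝓕 (Θ l : EuclideanSpace ℝ ι → ℂ) ξ := by
  set U : Lp (EuclideanSpace ℂ ι) 2 (volume : Measure (EuclideanSpace ℝ ι)) := physLp ha h2 with hU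
  set ΘLp : Lp (EuclideanSpace ℂ ι) 2 (volume : Measure (EuclideanSpace ℝ ι)) :=
    (memLp_schwartzVec Θ).toLp _ with hΘLp
  have hΘae : (ΘLp : EuclideanSpace ℝ ι → EuclideanSpace ℂ ι) =ᵐ[volume] schwartzVec Θ :=
    MemLp.coeFn_toLp _
  -- Step A: the left-hand side is the `L²` inner product `⟪U, Θ⟫`
  have hA : ∫ x, ∑ l, conj ((U : EuclideanSpace ℝ ι → EuclideanSpace ℂ ι) x l) * Θ l x = ⟪U, ΘLp⟫_ℂ := by
    rw [MeasureTheory.L2.inner_def]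
    refine integral_congr_ae ?_
    filter_upwards [hΘae] with x hx
    rw [hx, PiLp.inner_apply]
    exact Finset.sum_congr rfl fun l _ => by rw [RCLike.inner_apply', schwartzVec_apply]
  -- Step B: Plancherel and `𝓕 U = a(-·)`
  have hB : ⟪U, ΘLp⟫_ℂ = ⟪(memLp_negEuc ha h2).toLp (negEuc a),
      (𝓕 ΘLp : Lp (EuclideanSpace ℂ ι) 2 (volume : Measure (EuclideanSpace ℝ ι)))⟫_ℂ := by
    rw [← MeasureTheory.Lp.inner_fourier_eq U ΘLp, hU, fourier_physLp]
  -- Step C: unfold the right-hand inner product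
  have hF := fourier_toLp_ae_eq_vec (integrable_schwartzVec Θ) (memLp_schwartzVec Θ)
  have hC : ⟪(memLp_negEuc ha h2).toLp (negEuc a),
      (𝓕 ΘLp : Lp (EuclideanSpace ℂ ι) 2 (volume : Measure (EuclideanSpace ℝ ι)))⟫_ℂ =
      ∫ ξ, ∑ l, conj (a (-ξ) l) * 𝓕 (Θ l : EuclideanSpace ℝ ι → ℂ) ξ := by
    rw [MeasureTheory.L2.inner_def]
    refine integral_congr_ae ?_
    filter_upwards [MemLp.coeFn_toLp (memLp_negEuc ha h2), hF] with ξ h1 h2'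
    rw [h1, hΘLp, h2', PiLp.inner_apply]
    exact Finset.sum_congr rfl fun l _ => by
      rw [RCLike.inner_apply', negEuc_apply, fourier_schwartzVec_apply]
  -- Step D: Hermitian symmetry
  rw [hA, hB, hC]
  refine integral_congr_ae ?_
  filter_upwards [hsymm] with ξ hξ
  exact Finset.sum_congr rfl fun l _ => by rw [hξ l, Complex.conj_conj]

/-! ### Truncations `a 1_{‖ξ‖ ≤ R}`: integrable approximations of the data -/

/-- The frequency truncation `a_R = a 1_{‖ξ‖ ≤ R}` (in `L¹ ∩ L²` when `a ∈ L²`). [folklore] -/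
def trunc (a : EuclideanSpace ℝ ι → ι → ℂ) (R : ℝ) (ξ : EuclideanSpace ℝ ι) : ι → ℂ :=
  if ‖ξ‖ ≤ R then a ξ else 0

/-- The truncation is measurable. [folklore] -/
theorem measurable_trunc {a : EuclideanSpace ℝ ι → ι → ℂ} (ha : Measurable a) (R : ℝ) :
    Measurable (trunc a R) :=
  Measurable.ite (measurableSet_le measurable_norm measurable_const) ha measurable_const

/-- The truncation is dominated by the data. [folklore] -/
theorem enorm_trunc_le (a : EuclideanSpace ℝ ι → ι → ℂ) (R : ℝ) (ξ : EuclideanSpace ℝ ι) :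
    ‖trunc a R ξ‖ₑ ≤ ‖a ξ‖ₑ := by
  unfold trunc
  split_ifs <;> simp

/-- Coefficientwise domination of the truncation. [folklore] -/
theorem enorm_trunc_apply_le (a : EuclideanSpace ℝ ι → ι → ℂ) (R : ℝ) (ξ : EuclideanSpace ℝ ι) (k : ι) :
    ‖trunc a R ξ k‖ₑ ≤ ‖a ξ k‖ₑ := by
  unfold trunc
  split_ifs <;> simp

/-- So is the truncation error. [folklore] -/
theorem enorm_trunc_sub_le (a : EuclideanSpace ℝ ι → ι → ℂ) (R : ℝ) (ξ : EuclideanSpace ℝ ι) :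
    ‖trunc a R ξ - a ξ‖ₑ ≤ ‖a ξ‖ₑ := by
  unfold trunc
  split_ifs <;> simp

/-- The truncation error vanishes eventually at every frequency. [folklore] -/
theorem trunc_eq_self_of_le {a : EuclideanSpace ℝ ι → ι → ℂ} {R : ℝ} {ξ : EuclideanSpace ℝ ι}
    (h : ‖ξ‖ ≤ R) : trunc a R ξ = a ξ := if_pos h

/-- The truncation of Hermitian data is Hermitian. [folklore] -/
theorem trunc_conjSymm {a : EuclideanSpace ℝ ι → ι → ℂ}
    (hsymm : ∀ᵐ ξ : EuclideanSpace ℝ ι ∂volume, ∀ j, a (-ξ) j = conj (a ξ j)) (R : ℝ) :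
    ∀ᵐ ξ : EuclideanSpace ℝ ι ∂volume, ∀ j, trunc a R (-ξ) j = conj (trunc a R ξ j) := by
  filter_upwards [hsymm] with ξ hξ j
  unfold trunc
  rw [norm_neg]
  split_ifs <;> simp [hξ j]

/-- `∫⁻ ‖a_R‖² ≤ ∫⁻ ‖a‖²`. [folklore] -/
theorem lintegral_trunc_sq_le (a : EuclideanSpace ℝ ι → ι → ℂ) (R : ℝ) :
    ∫⁻ ξ, ‖trunc a R ξ‖ₑ ^ 2 ≤ ∫⁻ ξ, ‖a ξ‖ₑ ^ 2 :=
  lintegral_mono fun ξ => by gcongr; exact enorm_trunc_le a R ξ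

/-- **The reflected truncation is integrable** (`L²` on a ball; Cauchy–Schwarz). [folklore] -/
theorem integrable_negEuc_trunc {a : EuclideanSpace ℝ ι → ι → ℂ} (ha : Measurable a)
    (h2 : ∫⁻ ξ, ‖a ξ‖ₑ ^ 2 < ∞) (R : ℝ) : Integrable (negEuc (trunc a R)) := by
  have hm : MemLp (negEuc (trunc a R)) 2 volume :=
    memLp_negEuc (measurable_trunc ha R) ((lintegral_trunc_sq_le a R).trans_lt h2)
  have h1 : MemLp (negEuc (trunc a R)) 1 volume := by
    refine hm.mono_exponent_of_measure_support_ne_top (s := Metric.closedBall 0 R)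
      (fun ξ hξ => ?_) (measure_closedBall_lt_top.ne) (by norm_num)
    have hξ' : ¬ ‖ξ‖ ≤ R := by simpa [Metric.mem_closedBall, dist_zero_right] using hξ
    simp [negEuc, trunc, norm_neg, hξ', toEuc]
  exact memLp_one_iff_integrable.1 h1

/-- **The truncations converge to the data in `L²`**: `∫⁻ ‖a_n − a‖² → 0` (dominated
convergence). [folklore] -/
theorem tendsto_lintegral_trunc_sub {a : EuclideanSpace ℝ ι → ι → ℂ} (ha : Measurable a)
    (h2 : ∫⁻ ξ, ‖a ξ‖ₑ ^ 2 < ∞) :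
    Tendsto (fun n : ℕ => ∫⁻ ξ, ‖trunc a n ξ - a ξ‖ₑ ^ 2) atTop (𝓝 0) := by
  have h := tendsto_lintegral_of_dominated_convergence (fun ξ => ‖a ξ‖ₑ ^ 2)
    (F := fun (n : ℕ) ξ => ‖trunc a n ξ - a ξ‖ₑ ^ 2) (f := fun _ => 0)
    (fun n => ((measurable_trunc ha n).sub ha).enorm.pow_const _)
    (fun n => ae_of_all _ fun ξ => by dsimp only; gcongr; exact enorm_trunc_sub_le a n ξ) h2.ne ?_
  · simpa using h
  · refine ae_of_all _ fun ξ => ?_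
    refine tendsto_const_nhds.congr' ?_
    filter_upwards [eventually_ge_atTop ⌈‖ξ‖⌉₊] with n hn
    rw [trunc_eq_self_of_le ((Nat.le_ceil _).trans (Nat.cast_le.2 hn)), sub_self, enorm_zero,
      zero_pow two_ne_zero]

/-- Hence `∫⁻ ‖negEuc a_n − negEuc a‖² → 0`. [folklore] -/
theorem tendsto_lintegral_negEuc_trunc_sub {a : EuclideanSpace ℝ ι → ι → ℂ} (ha : Measurable a)
    (h2 : ∫⁻ ξ, ‖a ξ‖ₑ ^ 2 < ∞) :
    Tendsto (fun n : ℕ => ∫⁻ ξ, ‖negEuc (trunc a n) ξ - negEuc a ξ‖ₑ ^ 2) atTop (𝓝 0) := by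
  have hb : ∀ n : ℕ, ∫⁻ ξ, ‖negEuc (trunc a n) ξ - negEuc a ξ‖ₑ ^ 2 ≤
      (Fintype.card ι : ℝ≥0∞) ^ 2 * ∫⁻ ξ, ‖trunc a n ξ - a ξ‖ₑ ^ 2 := fun n => by
    have h := lintegral_enorm_negEuc_sq_le (fun ξ => trunc a n ξ - a ξ)
    refine le_trans (le_of_eq (lintegral_congr fun ξ => ?_)) h
    simp only [negEuc, toEuc_sub]
  have h0 : Tendsto (fun n : ℕ => (Fintype.card ι : ℝ≥0∞) ^ 2 * ∫⁻ ξ, ‖trunc a n ξ - a ξ‖ₑ ^ 2)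
      atTop (𝓝 0) := by
    simpa using ENNReal.Tendsto.const_mul (tendsto_lintegral_trunc_sub ha h2)
      (Or.inr (ENNReal.pow_ne_top (ENNReal.natCast_ne_top _)))
  exact tendsto_of_tendsto_of_tendsto_of_le_of_le tendsto_const_nhds h0 (fun n => zero_le) hb

/-- The `L²` classes of the reflected truncations. [folklore] -/
theorem memLp_negEuc_trunc {a : EuclideanSpace ℝ ι → ι → ℂ} (ha : Measurable a)
    (h2 : ∫⁻ ξ, ‖a ξ‖ₑ ^ 2 < ∞) (R : ℝ) : MemLp (negEuc (trunc a R)) 2 (volume : Measure (EuclideanSpace ℝ ι)) :=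
  memLp_negEuc (measurable_trunc ha R) ((lintegral_trunc_sq_le a R).trans_lt h2)

/-- **The reflected truncations converge in `L²`.** [folklore] -/
theorem tendsto_toLp_negEuc_trunc {a : EuclideanSpace ℝ ι → ι → ℂ} (ha : Measurable a)
    (h2 : ∫⁻ ξ, ‖a ξ‖ₑ ^ 2 < ∞) :
    Tendsto (fun n : ℕ => (memLp_negEuc_trunc ha h2 n).toLp (negEuc (trunc a n))) atTop
      (𝓝 ((memLp_negEuc ha h2).toLp (negEuc a))) := by
  rw [Lp.tendsto_Lp_iff_tendsto_eLpNorm'']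
  have h : ∀ n : ℕ, eLpNorm (negEuc (trunc a n) - negEuc a) 2 volume =
      (∫⁻ ξ, ‖negEuc (trunc a n) ξ - negEuc a ξ‖ₑ ^ 2) ^ (1 / 2 : ℝ) := fun n => by
    rw [eLpNorm_eq_lintegral_rpow_enorm_toReal (by norm_num) (by norm_num)]
    simp
  simp_rw [h]
  have h0 := (ENNReal.continuous_rpow_const (y := (1 / 2 : ℝ))).tendsto 0
  rw [ENNReal.zero_rpow_of_pos (by norm_num)] at h0
  exact h0.comp (tendsto_lintegral_negEuc_trunc_sub ha h2)

/-- **The physical classes of the truncations converge in `L²`** to the physical class. [folklore] -/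
theorem tendsto_fourierInv_negEuc_trunc {a : EuclideanSpace ℝ ι → ι → ℂ} (ha : Measurable a)
    (h2 : ∫⁻ ξ, ‖a ξ‖ₑ ^ 2 < ∞) :
    Tendsto (fun n : ℕ => (𝓕⁻ ((memLp_negEuc_trunc ha h2 n).toLp (negEuc (trunc a n))) :
      Lp (EuclideanSpace ℂ ι) 2 (volume : Measure (EuclideanSpace ℝ ι)))) atTop (𝓝 (physLp ha h2)) :=
  ((Lp.fourierTransformₗᵢ (EuclideanSpace ℝ ι) (EuclideanSpace ℂ ι)).symm.continuous.tendsto _).comp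
    (tendsto_toLp_negEuc_trunc ha h2)

/-! ### Reality of the physical class -/

/-- The inverse Fourier integral of the reflected truncation, coordinatewise. [folklore] -/
theorem fourierInv_negEuc_apply {b : EuclideanSpace ℝ ι → ι → ℂ} (hb : Integrable (negEuc b))
    (x : EuclideanSpace ℝ ι) (l : ι) :
    𝓕⁻ (negEuc b) x l = ∫ ξ : EuclideanSpace ℝ ι, 𝐞 ⟪ξ, x⟫_ℝ • b (-ξ) l := by
  rw [Real.fourierInv_eq]
  have hint : Integrable (fun ξ : EuclideanSpace ℝ ι => 𝐞 ⟪ξ, x⟫_ℝ • negEuc b ξ) := by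
    have h := (Real.fourierIntegral_convergent_iff (-x)).2 hb
    simpa [inner_neg_right] using h
  have h := (EuclideanSpace.proj (𝕜 := ℂ) l).integral_comp_comm hint
  simp only [PiLp.proj_apply] at h
  rw [← h]
  rfl

/-- **The inverse Fourier integral of Hermitian integrable data is real**:
`conj (𝓕⁻[b(-·)](x)_l) = 𝓕⁻[b(-·)](x)_l` when `b(-ξ) = conj b(ξ)` a.e. [folklore] -/
theorem conj_fourierInv_negEuc_apply {b : EuclideanSpace ℝ ι → ι → ℂ} (hb : Integrable (negEuc b))
    (hsymm : ∀ᵐ ξ : EuclideanSpace ℝ ι ∂volume, ∀ j, b (-ξ) j = conj (b ξ j))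
    (x : EuclideanSpace ℝ ι) (l : ι) :
    conj (𝓕⁻ (negEuc b) x l) = 𝓕⁻ (negEuc b) x l := by
  rw [fourierInv_negEuc_apply hb x l, ← integral_conj,
    ← integral_neg_eq_self (fun ξ : EuclideanSpace ℝ ι => (starRingEnd ℂ) (𝐞 ⟪ξ, x⟫_ℝ • b (-ξ) l)) volume]
  refine integral_congr_ae ?_
  have hsymm' : ∀ᵐ ξ : EuclideanSpace ℝ ι ∂volume, ∀ j, b (- -ξ) j = conj (b (-ξ) j) :=
    (Measure.measurePreserving_neg (volume : Measure (EuclideanSpace ℝ ι))).quasiMeasurePreserving.ae hsymm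
  filter_upwards [hsymm'] with ξ hξ
  rw [neg_neg] at hξ
  simp only [Circle.smul_def, smul_eq_mul, map_mul, Circle.starRingEnd_addChar, inner_neg_left, neg_neg]
  rw [hξ l, Complex.conj_conj]

/-- **Reality of the physical class**: for Hermitian `a`, `U = physLp` is a.e. real,
`conj U_l = U_l` (the truncated classes are pointwise real, `L²` limit along an a.e.-convergent
subsequence). [cite: Lemarierieusset2023, §8.7 (8.8) (PDF p. 198)] -/
theorem physLp_conj_ae {a : EuclideanSpace ℝ ι → ι → ℂ} (ha : Measurable a) (h2 : ∫⁻ ξ, ‖a ξ‖ₑ ^ 2 < ∞)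
    (hsymm : ∀ᵐ ξ : EuclideanSpace ℝ ι ∂volume, ∀ j, a (-ξ) j = conj (a ξ j)) :
    ∀ᵐ x : EuclideanSpace ℝ ι ∂volume, ∀ l,
      conj ((physLp ha h2 : EuclideanSpace ℝ ι → EuclideanSpace ℂ ι) x l) =
        (physLp ha h2 : EuclideanSpace ℝ ι → EuclideanSpace ℂ ι) x l := by
  set Un : ℕ → Lp (EuclideanSpace ℂ ι) 2 (volume : Measure (EuclideanSpace ℝ ι)) := fun n =>
    𝓕⁻ ((memLp_negEuc_trunc ha h2 n).toLp (negEuc (trunc a n))) with hUn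
  have hconv : Tendsto Un atTop (𝓝 (physLp ha h2)) := tendsto_fourierInv_negEuc_trunc ha h2
  -- convergence in measure and an a.e.-convergent subsequence
  have hmeas : TendstoInMeasure volume (fun n => (Un n : EuclideanSpace ℝ ι → EuclideanSpace ℂ ι)) atTop
      (physLp ha h2 : EuclideanSpace ℝ ι → EuclideanSpace ℂ ι) :=
    tendstoInMeasure_of_tendsto_eLpNorm two_ne_zero (fun n => Lp.aestronglyMeasurable _)
      (Lp.aestronglyMeasurable _) ((Lp.tendsto_Lp_iff_tendsto_eLpNorm' _ _).1 hconv)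
  obtain ⟨ns, hns, hlim⟩ := hmeas.exists_seq_tendsto_ae
  -- the truncated classes are pointwise real
  have hreal : ∀ᵐ x : EuclideanSpace ℝ ι ∂volume, ∀ n : ℕ, ∀ l,
      conj ((Un n : EuclideanSpace ℝ ι → EuclideanSpace ℂ ι) x l) =
        (Un n : EuclideanSpace ℝ ι → EuclideanSpace ℂ ι) x l := by
    rw [ae_all_iff]
    intro n
    filter_upwards [fourierInv_toLp_ae_eq_vec (integrable_negEuc_trunc ha h2 n)
      (memLp_negEuc_trunc ha h2 n)] with x hx l
    rw [hUn]
    dsimp only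
    rw [hx]
    exact conj_fourierInv_negEuc_apply (integrable_negEuc_trunc ha h2 n) (trunc_conjSymm hsymm n) x l
  filter_upwards [hlim, hreal] with x hx1 hx2 l
  have h1 : Tendsto (fun k => (Un (ns k) : EuclideanSpace ℝ ι → EuclideanSpace ℂ ι) x l) atTop
      (𝓝 ((physLp ha h2 : EuclideanSpace ℝ ι → EuclideanSpace ℂ ι) x l)) :=
    ((EuclideanSpace.proj (𝕜 := ℂ) l).continuous.tendsto _).comp hx1
  have h2' : Tendsto (fun k => conj ((Un (ns k) : EuclideanSpace ℝ ι → EuclideanSpace ℂ ι) x l)) atTop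
      (𝓝 (conj ((physLp ha h2 : EuclideanSpace ℝ ι → EuclideanSpace ℂ ι) x l))) :=
    (Complex.continuous_conj.tendsto _).comp h1
  rw [show (fun k => conj ((Un (ns k) : EuclideanSpace ℝ ι → EuclideanSpace ℂ ι) x l)) =
      fun k => (Un (ns k) : EuclideanSpace ℝ ι → EuclideanSpace ℂ ι) x l from
    funext fun k => hx2 (ns k) l] at h2'
  exact tendsto_nhds_unique h2' h1

/-! ### The quadratic pairing -/

open FourierNS in
/-- **The multiplication formula for products of Fourier integrals**: for integrable `f, g` and
Schwartz `θ`, `∫ 𝓕f(x) 𝓕g(x) θ(x) dx = ∫ (f ⋆ g)(ζ) 𝓕θ(ζ) dζ` (`𝓕f · 𝓕g = 𝓕(f ⋆ g)`,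
Mathlib `Real.fourier_mul_convolution_eq`, then self-adjointness of `𝓕` against `θ`). [folklore] -/
theorem integral_fourier_mul_fourier_mul {f g : EuclideanSpace ℝ ι → ℂ} (hf : Integrable f) (hg : Integrable g)
    (θ : 𝓢(EuclideanSpace ℝ ι, ℂ)) :
    ∫ x, 𝓕 f x * 𝓕 g x * θ x = ∫ ζ, fconv f g ζ * 𝓕 (θ : EuclideanSpace ℝ ι → ℂ) ζ := by
  have hconv : ∀ x, 𝓕 f x * 𝓕 g x = 𝓕 (fconv f g) x := fun x => by
    rw [fconv_eq, Real.fourier_mul_convolution_eq hf hg]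
  simp_rw [hconv]
  have h := integral_fourier_schwartz_smul_eq_vec (F := ℂ) (integrable_fconv hf hg) θ
  simp only [smul_eq_mul] at h
  calc ∫ x, 𝓕 (fconv f g) x * θ x = ∫ x, θ x * 𝓕 (fconv f g) x := by simp_rw [mul_comm]
    _ = ∫ x, 𝓕 (θ : EuclideanSpace ℝ ι → ℂ) x * fconv f g x := h.symm
    _ = ∫ ζ, fconv f g ζ * 𝓕 (θ : EuclideanSpace ℝ ι → ℂ) ζ := by simp_rw [mul_comm]

/-- Coefficients of the truncation are integrable. [folklore] -/
theorem integrable_trunc_apply {a : EuclideanSpace ℝ ι → ι → ℂ} (ha : Measurable a)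
    (h2 : ∫⁻ ξ, ‖a ξ‖ₑ ^ 2 < ∞) (R : ℝ) (k : ι) : Integrable (fun ξ => trunc a R ξ k) := by
  have h := ((integrable_negEuc_trunc ha h2 R).comp_neg)
  have h' := (EuclideanSpace.proj (𝕜 := ℂ) k).integrable_comp h
  simpa [negEuc] using h'

/-- Coefficients of square-integrable data are in `L²`. [folklore] -/
theorem memLp_apply {a : EuclideanSpace ℝ ι → ι → ℂ} (ha : Measurable a) (h2 : ∫⁻ ξ, ‖a ξ‖ₑ ^ 2 < ∞)
    (k : ι) : MemLp (fun ξ => a ξ k) 2 (volume : Measure (EuclideanSpace ℝ ι)) :=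
  memLp_two_of_lintegral_sq_lt_top ((measurable_pi_apply k).comp ha).aestronglyMeasurable
    (lt_of_le_of_lt (lintegral_mono fun ξ => by gcongr; exact enorm_apply_le_enorm (a ξ) k) h2)

/-- The inverse Fourier integral of the reflected truncation is the Fourier integral of the
truncation, coordinatewise: `𝓕⁻[b(-·)]_k = 𝓕[b_k]`. [folklore] -/
theorem fourierInv_negEuc_apply_eq_fourier {b : EuclideanSpace ℝ ι → ι → ℂ} (hb : Integrable (negEuc b))
    (x : EuclideanSpace ℝ ι) (k : ι) :
    𝓕⁻ (negEuc b) x k = 𝓕 (fun ξ => b ξ k) x := by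
  rw [fourierInv_negEuc_apply hb x k, Real.fourier_eq,
    ← integral_neg_eq_self (fun ξ : EuclideanSpace ℝ ι => 𝐞 ⟪ξ, x⟫_ℝ • b (-ξ) k) volume]
  simp only [inner_neg_left, neg_neg]

omit [Fintype ι] in
/-- **Hölder in `L²`, `lintegral` form**: `∫⁻ ‖φ ψ‖ ≤ ‖φ‖_{L²} ‖ψ‖_{L²}`. [folklore] -/
theorem lintegral_enorm_mul_le_eLpNorm_mul {X : Type*} [MeasurableSpace X] {μ : Measure X}
    {φ ψ : X → ℂ} (hφ : AEStronglyMeasurable φ μ) (hψ : AEStronglyMeasurable ψ μ) :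
    ∫⁻ x, ‖φ x * ψ x‖ₑ ∂μ ≤ eLpNorm φ 2 μ * eLpNorm ψ 2 μ := by
  have h := ENNReal.lintegral_mul_le_Lp_mul_Lq μ Real.HolderConjugate.two_two hφ.enorm hψ.enorm
  rw [eLpNorm_eq_lintegral_rpow_enorm_toReal (by norm_num) (by norm_num),
    eLpNorm_eq_lintegral_rpow_enorm_toReal (by norm_num) (by norm_num)]
  simp only [ENNReal.toReal_ofNat] at *
  refine le_trans (le_of_eq (lintegral_congr fun x => ?_)) h
  rw [Pi.mul_apply, enorm_mul]

omit [Fintype ι] in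
/-- A component of an `L²`-convergent sequence of vector fields converges in `L²`. [folklore] -/
theorem tendsto_eLpNorm_apply_sub {X : Type*} [MeasurableSpace X] {μ : Measure X} [Fintype ι]
    {V : ℕ → X → EuclideanSpace ℂ ι} {W : X → EuclideanSpace ℂ ι}
    (h : Tendsto (fun n => eLpNorm (V n - W) 2 μ) atTop (𝓝 0)) (k : ι) :
    Tendsto (fun n => eLpNorm (fun x => V n x k - W x k) 2 μ) atTop (𝓝 0) :=
  tendsto_of_tendsto_of_tendsto_of_le_of_le tendsto_const_nhds h (fun n => zero_le) fun n =>
    eLpNorm_mono fun x => by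
      rw [← PiLp.sub_apply]
      exact PiLp.norm_apply_le _ k

omit [Fintype ι] in
/-- **Continuity of the trilinear pairing `∫ φ ψ θ`** in `(φ, ψ) ∈ L² × L²` for bounded `θ`
(Hölder; the `L¹` distance is `≤ ‖θ‖_∞ (‖φ_n-φ‖ ‖ψ_n‖ + ‖φ‖ ‖ψ_n-ψ‖)`). [folklore] -/
theorem tendsto_integral_mul_mul {X : Type*} [MeasurableSpace X] {μ : Measure X}
    {φn ψn : ℕ → X → ℂ} {φ ψ θ : X → ℂ}
    (hφn : ∀ n, MemLp (φn n) 2 μ) (hψn : ∀ n, MemLp (ψn n) 2 μ) (hφ : MemLp φ 2 μ) (hψ : MemLp ψ 2 μ)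
    (hθ : AEStronglyMeasurable θ μ) {C : ℝ} (hθC : ∀ x, ‖θ x‖ ≤ C)
    (h1 : Tendsto (fun n => eLpNorm (φn n - φ) 2 μ) atTop (𝓝 0))
    (h2 : Tendsto (fun n => eLpNorm (ψn n - ψ) 2 μ) atTop (𝓝 0)) :
    Tendsto (fun n => ∫ x, φn n x * ψn n x * θ x ∂μ) atTop (𝓝 (∫ x, φ x * ψ x * θ x ∂μ)) := by
  have hint : ∀ {f g : X → ℂ}, MemLp f 2 μ → MemLp g 2 μ →
      Integrable (fun x => f x * g x * θ x) μ := by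
    intro f g hf hg
    have hfg : Integrable (fun x => f x * g x) μ := hf.integrable_mul hg
    exact hfg.mul_bdd hθ (Eventually.of_forall hθC)
  refine tendsto_integral_of_L1 _ (hint hφ hψ).aestronglyMeasurable
    (Eventually.of_forall fun n => hint (hφn n) (hψn n)) ?_
  -- the `L¹` distance
  have hbound : ∀ n, ∫⁻ x, ‖φn n x * ψn n x * θ x - φ x * ψ x * θ x‖ₑ ∂μ ≤
      ENNReal.ofReal C * (eLpNorm (φn n - φ) 2 μ * eLpNorm (ψn n) 2 μ +
        eLpNorm φ 2 μ * eLpNorm (ψn n - ψ) 2 μ) := by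
    intro n
    have hsplit : ∀ x, φn n x * ψn n x * θ x - φ x * ψ x * θ x =
        θ x * ((φn n x - φ x) * ψn n x + φ x * (ψn n x - ψ x)) := fun x => by ring
    have hm : AEMeasurable (fun x => ‖(φn n x - φ x) * ψn n x‖ₑ) μ :=
      (((hφn n).1.sub hφ.1).mul (hψn n).1).enorm
    calc ∫⁻ x, ‖φn n x * ψn n x * θ x - φ x * ψ x * θ x‖ₑ ∂μ
        = ∫⁻ x, ‖θ x‖ₑ * ‖(φn n x - φ x) * ψn n x + φ x * (ψn n x - ψ x)‖ₑ ∂μ := by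
          simp_rw [hsplit, enorm_mul]
      _ ≤ ∫⁻ x, ENNReal.ofReal C * (‖(φn n x - φ x) * ψn n x‖ₑ + ‖φ x * (ψn n x - ψ x)‖ₑ) ∂μ := by
          refine lintegral_mono fun x => mul_le_mul' ?_ (enorm_add_le _ _)
          rw [← ofReal_norm]
          exact ENNReal.ofReal_le_ofReal (hθC x)
      _ = ENNReal.ofReal C * ((∫⁻ x, ‖(φn n x - φ x) * ψn n x‖ₑ ∂μ) +
            ∫⁻ x, ‖φ x * (ψn n x - ψ x)‖ₑ ∂μ) := by
          rw [lintegral_const_mul' _ _ ENNReal.ofReal_ne_top, lintegral_add_left' hm]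
      _ ≤ ENNReal.ofReal C * (eLpNorm (φn n - φ) 2 μ * eLpNorm (ψn n) 2 μ +
            eLpNorm φ 2 μ * eLpNorm (ψn n - ψ) 2 μ) := by
          gcongr
          · exact lintegral_enorm_mul_le_eLpNorm_mul ((hφn n).1.sub hφ.1) (hψn n).1
          · exact lintegral_enorm_mul_le_eLpNorm_mul hφ.1 ((hψn n).1.sub hψ.1)
  -- `‖ψ_n‖ ≤ ‖ψ_n - ψ‖ + ‖ψ‖`
  have hψn_le : ∀ n, eLpNorm (ψn n) 2 μ ≤ eLpNorm (ψn n - ψ) 2 μ + eLpNorm ψ 2 μ := fun n => by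
    have h := eLpNorm_add_le ((hψn n).1.sub hψ.1) hψ.1 (p := 2) (μ := μ) one_le_two
    rwa [sub_add_cancel] at h
  -- the bound tends to `0`
  have hψfin : eLpNorm ψ 2 μ ≠ ∞ := hψ.eLpNorm_ne_top
  have hφfin : eLpNorm φ 2 μ ≠ ∞ := hφ.eLpNorm_ne_top
  have t1 : Tendsto (fun n => eLpNorm (ψn n - ψ) 2 μ + eLpNorm ψ 2 μ) atTop (𝓝 (0 + eLpNorm ψ 2 μ)) :=
    h2.add tendsto_const_nhds
  have t2 : Tendsto (fun n => eLpNorm (φn n - φ) 2 μ * (eLpNorm (ψn n - ψ) 2 μ + eLpNorm ψ 2 μ)) atTop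
      (𝓝 (0 * (0 + eLpNorm ψ 2 μ))) :=
    ENNReal.Tendsto.mul h1 (Or.inr (by simpa using hψfin)) t1 (Or.inr ENNReal.zero_ne_top)
  have t3 : Tendsto (fun n => eLpNorm φ 2 μ * eLpNorm (ψn n - ψ) 2 μ) atTop (𝓝 (eLpNorm φ 2 μ * 0)) :=
    ENNReal.Tendsto.const_mul h2 (Or.inr hφfin)
  have t4 : Tendsto (fun n => ENNReal.ofReal C * (eLpNorm (φn n - φ) 2 μ *
      (eLpNorm (ψn n - ψ) 2 μ + eLpNorm ψ 2 μ) + eLpNorm φ 2 μ * eLpNorm (ψn n - ψ) 2 μ)) atTop (𝓝 0) := by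
    have h := ENNReal.Tendsto.const_mul (t2.add t3) (Or.inr ENNReal.ofReal_ne_top) (a := ENNReal.ofReal C)
    simpa using h
  refine tendsto_of_tendsto_of_tendsto_of_le_of_le tendsto_const_nhds t4 (fun n => zero_le) fun n =>
    (hbound n).trans ?_
  gcongr
  exact hψn_le n

open FourierNS in
/-- **Cauchy–Schwarz bound of the convolution of `L²` functions**: `‖(f ⋆ g)(ζ)‖ ≤ ‖f‖₂ ‖g‖₂`. [folklore] -/
theorem enorm_fconv_le_eLpNorm_mul {f g : EuclideanSpace ℝ ι → ℂ} (hf : AEStronglyMeasurable f volume)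
    (hg : AEStronglyMeasurable g volume) (ζ : EuclideanSpace ℝ ι) :
    ‖fconv f g ζ‖ₑ ≤ eLpNorm f 2 volume * eLpNorm g 2 volume := by
  rw [fconv_apply]
  refine (enorm_integral_le_lintegral_enorm _).trans ?_
  have hmp := Measure.measurePreserving_sub_left (volume : Measure (EuclideanSpace ℝ ι)) ζ
  have hg' : AEStronglyMeasurable (fun η => g (ζ - η)) volume := hg.comp_measurePreserving hmp
  refine (lintegral_enorm_mul_le_eLpNorm_mul hf hg').trans (le_of_eq ?_)
  rw [show (fun η => g (ζ - η)) = g ∘ (fun η => ζ - η) from rfl, eLpNorm_comp_measurePreserving hg hmp]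

/-- Coordinates of an `L²` class of vector fields are in `L²`. [folklore] -/
theorem memLp_coord (U : Lp (EuclideanSpace ℂ ι) 2 (volume : Measure (EuclideanSpace ℝ ι))) (k : ι) :
    MemLp (fun x => (U : EuclideanSpace ℝ ι → EuclideanSpace ℂ ι) x k) 2 volume := by
  have := (EuclideanSpace.proj (𝕜 := ℂ) k).comp_memLp' (Lp.memLp U)
  simpa [Function.comp_def] using this

open FourierNS in
/-- **Convergence of the truncated convolutions**: `(a_{n,j} ⋆ a_{n,l})(ζ) → (a_j ⋆ a_l)(ζ)` at every
`ζ` (dominated convergence in `η`, domination by `|a_j(η)| |a_l(ζ-η)| ∈ L¹`). [folklore] -/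
theorem tendsto_fconv_trunc {a : EuclideanSpace ℝ ι → ι → ℂ} (ha : Measurable a) (h2 : ∫⁻ ξ, ‖a ξ‖ₑ ^ 2 < ∞)
    (j l : ι) (ζ : EuclideanSpace ℝ ι) :
    Tendsto (fun n : ℕ => fconv (fun ξ => trunc a n ξ j) (fun ξ => trunc a n ξ l) ζ) atTop
      (𝓝 (fconv (fun ξ => a ξ j) (fun ξ => a ξ l) ζ)) := by
  simp_rw [fconv_apply]
  have hmp := Measure.measurePreserving_sub_left (volume : Measure (EuclideanSpace ℝ ι)) ζ
  have hint : Integrable (fun η => a η j * a (ζ - η) l) := by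
    have h := (memLp_apply ha h2 j).integrable_mul ((memLp_apply ha h2 l).comp_measurePreserving hmp)
    exact h
  refine tendsto_integral_of_dominated_convergence (fun η => ‖a η j * a (ζ - η) l‖) (fun n => ?_) hint.norm
    (fun n => ae_of_all _ fun η => ?_) (ae_of_all _ fun η => ?_)
  · exact (((measurable_pi_apply j).comp (measurable_trunc ha n)).mul
      ((measurable_pi_apply l).comp ((measurable_trunc ha n).comp (measurable_const.sub measurable_id)))).aestronglyMeasurable
  · rw [norm_mul, norm_mul]
    refine mul_le_mul ?_ ?_ (norm_nonneg _) (norm_nonneg _)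
    · unfold trunc
      split_ifs <;> simp
    · unfold trunc
      split_ifs <;> simp
  · refine tendsto_const_nhds.congr' ?_
    filter_upwards [eventually_ge_atTop ⌈max ‖η‖ ‖ζ - η‖⌉₊] with n hn
    have hn' : (⌈max ‖η‖ ‖ζ - η‖⌉₊ : ℝ) ≤ n := Nat.cast_le.2 hn
    have h1 : ‖η‖ ≤ n := ((le_max_left _ _).trans (Nat.le_ceil _)).trans hn'
    have h2' : ‖ζ - η‖ ≤ n := ((le_max_right _ _).trans (Nat.le_ceil _)).trans hn'
    rw [trunc_eq_self_of_le h1, trunc_eq_self_of_le h2']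

open FourierNS in
/-- **The quadratic pairing**: for a measurable, square-integrable, Hermitian coefficient field
`a`, Schwartz `θ` and components `j, l`, `∫ U_j U_l θ dx = ∫ (a_j ⋆ a_l)(ζ) 𝓕θ(ζ) dζ` with
`U = physLp` (the multiplication formula for the integrable truncations `a 1_{‖ξ‖≤n}`, passed to
the limit: `L²` convergence of the physical classes on the left, dominated convergence on the
right; Lemarié-Rieusset 2023, §8.7 (8.8): "`U ∗ U`, the Fourier transform of `u ⊗ u`"). [cite: Lemarierieusset2023, §8.7 (8.8) (PDF p. 198)] -/
theorem integral_physLp_mul_physLp_mul {a : EuclideanSpace ℝ ι → ι → ℂ} (ha : Measurable a)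
    (h2 : ∫⁻ ξ, ‖a ξ‖ₑ ^ 2 < ∞) (θ : 𝓢(EuclideanSpace ℝ ι, ℂ)) (j l : ι) :
    ∫ x, (physLp ha h2 : EuclideanSpace ℝ ι → EuclideanSpace ℂ ι) x j *
        (physLp ha h2 : EuclideanSpace ℝ ι → EuclideanSpace ℂ ι) x l * θ x =
      ∫ ζ, fconv (fun ξ => a ξ j) (fun ξ => a ξ l) ζ * 𝓕 (θ : EuclideanSpace ℝ ι → ℂ) ζ := by
  set U : Lp (EuclideanSpace ℂ ι) 2 (volume : Measure (EuclideanSpace ℝ ι)) := physLp ha h2 with hU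
  set Un : ℕ → Lp (EuclideanSpace ℂ ι) 2 (volume : Measure (EuclideanSpace ℝ ι)) := fun n =>
    𝓕⁻ ((memLp_negEuc_trunc ha h2 n).toLp (negEuc (trunc a n))) with hUn
  have hconv : Tendsto Un atTop (𝓝 U) := tendsto_fourierInv_negEuc_trunc ha h2
  have hconv' := (Lp.tendsto_Lp_iff_tendsto_eLpNorm' _ _).1 hconv
  -- the identity for the truncations
  have hn : ∀ n : ℕ, ∫ x, (Un n : EuclideanSpace ℝ ι → EuclideanSpace ℂ ι) x j *
      (Un n : EuclideanSpace ℝ ι → EuclideanSpace ℂ ι) x l * θ x =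
      ∫ ζ, fconv (fun ξ => trunc a n ξ j) (fun ξ => trunc a n ξ l) ζ * 𝓕 (θ : EuclideanSpace ℝ ι → ℂ) ζ := by
    intro n
    have hI := integrable_negEuc_trunc ha h2 n
    have hae := fourierInv_toLp_ae_eq_vec hI (memLp_negEuc_trunc ha h2 n)
    calc ∫ x, (Un n : EuclideanSpace ℝ ι → EuclideanSpace ℂ ι) x j *
          (Un n : EuclideanSpace ℝ ι → EuclideanSpace ℂ ι) x l * θ x
        = ∫ x, 𝓕 (fun ξ => trunc a n ξ j) x * 𝓕 (fun ξ => trunc a n ξ l) x * θ x := by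
          refine integral_congr_ae ?_
          filter_upwards [hae] with x hx
          rw [hUn]
          dsimp only
          rw [hx, fourierInv_negEuc_apply_eq_fourier hI, fourierInv_negEuc_apply_eq_fourier hI]
      _ = _ := integral_fourier_mul_fourier_mul (integrable_trunc_apply ha h2 n j)
          (integrable_trunc_apply ha h2 n l) θ
  -- the left-hand sides converge (`L²` convergence of the physical classes)
  obtain ⟨C, hC⟩ : ∃ C, ∀ x, ‖θ x‖ ≤ C :=
    ⟨‖θ.toBoundedContinuousFunction‖, fun x => θ.toBoundedContinuousFunction.norm_coe_le_norm x⟩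
  have hL : Tendsto (fun n => ∫ x, (Un n : EuclideanSpace ℝ ι → EuclideanSpace ℂ ι) x j *
      (Un n : EuclideanSpace ℝ ι → EuclideanSpace ℂ ι) x l * θ x) atTop
      (𝓝 (∫ x, (U : EuclideanSpace ℝ ι → EuclideanSpace ℂ ι) x j *
        (U : EuclideanSpace ℝ ι → EuclideanSpace ℂ ι) x l * θ x)) :=
    tendsto_integral_mul_mul (fun n => memLp_coord (Un n) j) (fun n => memLp_coord (Un n) l)
      (memLp_coord U j) (memLp_coord U l) θ.continuous.aestronglyMeasurable hC
      (tendsto_eLpNorm_apply_sub hconv' j) (tendsto_eLpNorm_apply_sub hconv' l)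
  -- the right-hand sides converge (dominated convergence)
  have hR : Tendsto (fun n : ℕ => ∫ ζ, fconv (fun ξ => trunc a n ξ j) (fun ξ => trunc a n ξ l) ζ *
      𝓕 (θ : EuclideanSpace ℝ ι → ℂ) ζ) atTop
      (𝓝 (∫ ζ, fconv (fun ξ => a ξ j) (fun ξ => a ξ l) ζ * 𝓕 (θ : EuclideanSpace ℝ ι → ℂ) ζ)) := by
    set S : ℝ≥0∞ := eLpNorm (fun ξ => a ξ j) 2 volume * eLpNorm (fun ξ => a ξ l) 2 volume with hS
    have hSfin : S ≠ ∞ :=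
      ENNReal.mul_ne_top (memLp_apply ha h2 j).eLpNorm_ne_top (memLp_apply ha h2 l).eLpNorm_ne_top
    have hFθ : Integrable (𝓕 (θ : EuclideanSpace ℝ ι → ℂ)) := by
      rw [← SchwartzMap.fourier_coe]
      exact (𝓕 θ).integrable
    have hbd : ∀ (n : ℕ) ζ, ‖fconv (fun ξ => trunc a n ξ j) (fun ξ => trunc a n ξ l) ζ‖ ≤ S.toReal := by
      intro n ζ
      have h1 : ‖fconv (fun ξ => trunc a n ξ j) (fun ξ => trunc a n ξ l) ζ‖ₑ ≤ S := by
        refine (enorm_fconv_le_eLpNorm_mul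
          ((measurable_pi_apply j).comp (measurable_trunc ha n)).aestronglyMeasurable
          ((measurable_pi_apply l).comp (measurable_trunc ha n)).aestronglyMeasurable ζ).trans ?_
        refine mul_le_mul' (eLpNorm_mono_enorm fun ξ => ?_) (eLpNorm_mono_enorm fun ξ => ?_)
        · simpa only [Function.comp_apply] using enorm_trunc_apply_le a n ξ j
        · simpa only [Function.comp_apply] using enorm_trunc_apply_le a n ξ l
      rw [← toReal_enorm]
      exact ENNReal.toReal_mono hSfin h1
    refine tendsto_integral_of_dominated_convergence (fun ζ => S.toReal * ‖𝓕 (θ : EuclideanSpace ℝ ι → ℂ) ζ‖)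
      (fun n => ?_) (hFθ.norm.const_mul _) (fun n => ae_of_all _ fun ζ => ?_) (ae_of_all _ fun ζ => ?_)
    · exact (integrable_fconv (integrable_trunc_apply ha h2 n j)
        (integrable_trunc_apply ha h2 n l)).aestronglyMeasurable.mul hFθ.aestronglyMeasurable
    · rw [norm_mul]
      exact mul_le_mul_of_nonneg_right (hbd n ζ) (norm_nonneg _)
    · exact (tendsto_fconv_trunc ha h2 j l ζ).mul tendsto_const_nhds
  -- conclude
  simp_rw [hn] at hL
  exact tendsto_nhds_unique hL hR

end Phys

end Literature.Analysis.FluidPDE.FujitaKato
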